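import Summits.QuantumFields.YangMills.Theorems.FluctuationComparisonRegPrIntLS2BetaCubeShellModulus
import HarnessLib

/-!
# S2β · D-GUARD ∕ (BG∞) — (L-S) FILE 1∕2: THE OFFSET ALGEBRA OF CUBES AND STEPS — the `Function.update` bookkeeping of the cube `t|_{α↦i, β↦k, γ↦l}` of an
# offset vector `t : Fin d → ℕ` (three distinct axes `α, β, γ`), its unit steps, and the converter from PER-BOND shell steps to S0's symmetric adjacency letter
# (px5 g24's ✓p840047 (L-T) §1 `uu_…`∕`slice_step_…`∕`ringAdj_of_steps` ONE DIMENSION UP; consumed by FILE 2∕2 `…SqrtGaugeStageSBlock`)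

Cell `ym3-torus` (YM ladder rung R3 = continuum `SU(2)` Yang–Mills on the three-torus at fixed lattice data — a RUNG: NOT d = 4, NOT infinite volume,
NOT a mass gap, NOT Clay).  Width seat «width 8» `ym3-torus-px8` (gen 28, toron∕flux lineage ✓p826411 → px17 (W1) ✓p837971), FREE px helper on crux
`stmt-QuantumFields-20520`; `--kind proof --supports stmt-QuantumFields-20520 --as helper`, count-neutral, DEFINITION-FREE (0 `def`, 0 `instance`, 0 `notation`,
0 `sorry`, default heartbeats).  NAMED (L-S) «STAGE S ON A BLOCK» by px19 g25 (STATUS 2026-09-01T01:58:23Z «YOURS … the literal 3-D twin of (L-I)») with px5 g24's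
(L-T) ✓p840047 as the template (02:01:22Z «(L-S) template: replace `(α, β)` + slice datum by the three offsets, T2∕T0 by S2∕S0»); split in two files for the
400-line rule.

WHY.  In the descent formulation (UV3-NODE §116 ADD.1) a stage-3 block carries on every `(α, β, γ)`-cube (the other offsets fixed) the cone filling S2 ✓p839993 of the
cube's shell data, `W t := Wc ψ_t (t α, t β, t γ)` with the CUBE DATUM `ψ_t (i, k, l) := φ (t|_{α↦i, β↦k, γ↦l})`.  A bond inside the block is ONE unit step of ONE
offset (✓p839889 `read_tgt_eq`): an `α`-, `β`- or `γ`-step keeps `ψ_t` and moves one cube coordinate, a step in a fourth direction `δ` (absent when `d = 3`) changes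
the cube.  THIS FILE is that bookkeeping, plus the passage from the three families of FORWARD shell steps (the shape in which per-bond letters arrive) to the
symmetric `|P − Q|₁ = 1` letter `hadj` of S0 ✓p840009 `dist1_shell_le_two_mul_l1`.

WHAT IS PROVED (sorry-free; def-free; `update` algebra generic in `d` and in the value type; the converter generic in `[GaugeGroup G]`).
* `uuu_apply_fst∕snd∕thd∕of_ne` (coordinates of the cube point), `uuu_mem_cube` (the cube point lies in the cube of `t`), `uuu_step_fst∕snd∕thd` (a unit step of a
  cube coordinate is the next cube point), `uuu_step_of_ne` (a `δ`-step, `δ ∉ {α, β, γ}`, is the cube point of the stepped `t`), `cube_step_fst∕snd∕thd` (the cube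
  datum is constant along `α`-, `β`-, `γ`-steps of `t`).
* ★ `shellAdj_of_steps (n) (ψ) (h1 h2 h3 : the three forward shell-step bounds ≤ η) : ∀ P Q on the shell, |P − Q|₁ = 1 → dist1 (ψ P·(ψ Q)⁻¹) ≤ η` — S0's `hadj`,
  argument for argument (backward steps by `dist1 g⁻¹ = dist1 g`).

HONEST SCOPE.  Elementary bookkeeping; no gauge field, no sphere geometry; nothing of Bałaban's renormalisation-group analysis is asserted, proved or refuted
([Balaban1985RegularSpaces] Lemma 1 p.79 ∕ Thm 2 p.83: LOCAL small gauges — the object the (BG∞) road globalises; consistent, not used).  (BG∞) ∕ `hBG` ∕ `hSec`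
(✓p840037's displayed hypothesis) remain OPEN; GAP♯∘ (`stub_uniformFibreGapOrbit`; registry v11 3732b7df UNTOUCHED), the five registered stubs (0∕5), S2β, crux 20520,
19936, 19200, `YM3TorusSU2` are NOT proved; no registered stub is closed; rung R3 = `SU(2)` YM₃ on T³ at fixed lattice data — NOT d = 4, NOT infinite volume, NOT a
mass gap, NOT Clay; the Yang–Mills mass gap is NOT proved.  Axioms standard.
References: T. Bałaban, CMP **99** (1985) 75–102 [Balaban1985RegularSpaces] (Lemma 1 p.79, Thm 2 p.83).
-/

set_option autoImplicit false

namespace Summit.QuantumFields.YangMills.Theorems.FluctuationComparisonRegPrIntLS2BetaCubeOffsetAlgebra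

open Literature.MathematicalPhysics.QuantumFieldTheory.Balaban1983to89

/-! ## §1 Offset algebra of cubes and steps -/

/-- The cube point `t|_{α↦i, β↦k, γ↦l}` has `α`-offset `i` (`α ∉ {β, γ}`). [folklore] -/
theorem uuu_apply_fst {d : ℕ} (t : Fin d → ℕ) {α β γ : Fin d} (hαβ : α ≠ β) (hαγ : α ≠ γ) (i k l : ℕ) :
    Function.update (Function.update (Function.update t α i) β k) γ l α = i := by
  rw [Function.update_of_ne hαγ, Function.update_of_ne hαβ, Function.update_self]

/-- The cube point has `β`-offset `k` (`β ≠ γ`). [folklore] -/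
theorem uuu_apply_snd {d : ℕ} (t : Fin d → ℕ) (α : Fin d) {β γ : Fin d} (hβγ : β ≠ γ) (i k l : ℕ) :
    Function.update (Function.update (Function.update t α i) β k) γ l β = k := by
  rw [Function.update_of_ne hβγ, Function.update_self]

/-- The cube point has `γ`-offset `l`. [folklore] -/
theorem uuu_apply_thd {d : ℕ} (t : Fin d → ℕ) (α β γ : Fin d) (i k l : ℕ) :
    Function.update (Function.update (Function.update t α i) β k) γ l γ = l := Function.update_self ..

/-- The cube point agrees with `t` off `{α, β, γ}`. [folklore] -/
theorem uuu_apply_of_ne {d : ℕ} (t : Fin d → ℕ) {α β γ κ : Fin d} (hκα : κ ≠ α) (hκβ : κ ≠ β) (hκγ : κ ≠ γ) (i k l : ℕ) :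
    Function.update (Function.update (Function.update t α i) β k) γ l κ = t κ := by
  rw [Function.update_of_ne hκγ, Function.update_of_ne hκβ, Function.update_of_ne hκα]

/-- The cube point lies in the cube of `t`. [folklore] -/
theorem uuu_mem_cube {d : ℕ} (t : Fin d → ℕ) {α β γ : Fin d} (hαβ : α ≠ β) (hαγ : α ≠ γ) (hβγ : β ≠ γ) (i k l : ℕ) :
    Function.update (Function.update (Function.update
      (Function.update (Function.update (Function.update t α i) β k) γ l) α (t α)) β (t β)) γ (t γ) = t := by
  funext κ
  by_cases hκγ : κ = γ
  · subst hκγ; rw [Function.update_self]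
  rw [Function.update_of_ne hκγ]
  by_cases hκβ : κ = β
  · subst hκβ; rw [Function.update_self]
  rw [Function.update_of_ne hκβ]
  by_cases hκα : κ = α
  · subst hκα; rw [Function.update_self]
  rw [Function.update_of_ne hκα, Function.update_of_ne hκγ, Function.update_of_ne hκβ, Function.update_of_ne hκα]

/-- An `α`-step from the cube point is the cube point with `i + 1`. [folklore] -/
theorem uuu_step_fst {d : ℕ} (t : Fin d → ℕ) {α β γ : Fin d} (hαβ : α ≠ β) (hαγ : α ≠ γ) (i k l : ℕ) :
    Function.update (Function.update (Function.update (Function.update t α i) β k) γ l) α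
        (Function.update (Function.update (Function.update t α i) β k) γ l α + 1) =
      Function.update (Function.update (Function.update t α (i + 1)) β k) γ l := by
  rw [uuu_apply_fst t hαβ hαγ]
  funext κ
  simp only [Function.update_apply]
  split_ifs <;> simp_all

/-- A `β`-step from the cube point is the cube point with `k + 1`. [folklore] -/
theorem uuu_step_snd {d : ℕ} (t : Fin d → ℕ) (α : Fin d) {β γ : Fin d} (hβγ : β ≠ γ) (i k l : ℕ) :
    Function.update (Function.update (Function.update (Function.update t α i) β k) γ l) β
        (Function.update (Function.update (Function.update t α i) β k) γ l β + 1) =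
      Function.update (Function.update (Function.update t α i) β (k + 1)) γ l := by
  rw [uuu_apply_snd t α hβγ]
  funext κ
  simp only [Function.update_apply]
  split_ifs <;> simp_all

/-- A `γ`-step from the cube point is the cube point with `l + 1`. [folklore] -/
theorem uuu_step_thd {d : ℕ} (t : Fin d → ℕ) (α β γ : Fin d) (i k l : ℕ) :
    Function.update (Function.update (Function.update (Function.update t α i) β k) γ l) γ
        (Function.update (Function.update (Function.update t α i) β k) γ l γ + 1) =
      Function.update (Function.update (Function.update t α i) β k) γ (l + 1) := by
  rw [uuu_apply_thd, Function.update_idem]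

/-- A `δ`-step (`δ ∉ {α, β, γ}`) from the cube point is the cube point of the stepped `t`. [folklore] -/
theorem uuu_step_of_ne {d : ℕ} (t : Fin d → ℕ) {α β γ δ : Fin d} (hδα : δ ≠ α) (hδβ : δ ≠ β) (hδγ : δ ≠ γ) (i k l v : ℕ) :
    Function.update (Function.update (Function.update (Function.update t α i) β k) γ l) δ v =
      Function.update (Function.update (Function.update (Function.update t δ v) α i) β k) γ l := by
  funext κ
  simp only [Function.update_apply]
  split_ifs <;> simp_all

/-- An `α`-step of `t` keeps the cube datum. [folklore] -/
theorem cube_step_fst {d : ℕ} {G : Type*} (φ : (Fin d → ℕ) → G) (t : Fin d → ℕ) (α β γ : Fin d) (v : ℕ) :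
    (fun p : ℕ × ℕ × ℕ => φ (Function.update (Function.update (Function.update (Function.update t α v) α p.1) β p.2.1) γ p.2.2)) =
      fun p : ℕ × ℕ × ℕ => φ (Function.update (Function.update (Function.update t α p.1) β p.2.1) γ p.2.2) := by
  funext p
  rw [Function.update_idem]

/-- A `β`-step of `t` keeps the cube datum (`α ≠ β`). [folklore] -/
theorem cube_step_snd {d : ℕ} {G : Type*} (φ : (Fin d → ℕ) → G) (t : Fin d → ℕ) {α β : Fin d} (γ : Fin d) (hαβ : α ≠ β) (v : ℕ) :
    (fun p : ℕ × ℕ × ℕ => φ (Function.update (Function.update (Function.update (Function.update t β v) α p.1) β p.2.1) γ p.2.2)) =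
      fun p : ℕ × ℕ × ℕ => φ (Function.update (Function.update (Function.update t α p.1) β p.2.1) γ p.2.2) := by
  funext p
  rw [Function.update_comm (Ne.symm hαβ) v p.1 t, Function.update_idem]

/-- A `γ`-step of `t` keeps the cube datum (`γ ∉ {α, β}`). [folklore] -/
theorem cube_step_thd {d : ℕ} {G : Type*} (φ : (Fin d → ℕ) → G) (t : Fin d → ℕ) {α β γ : Fin d} (hαγ : α ≠ γ) (hβγ : β ≠ γ) (v : ℕ) :
    (fun p : ℕ × ℕ × ℕ => φ (Function.update (Function.update (Function.update (Function.update t γ v) α p.1) β p.2.1) γ p.2.2)) =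
      fun p : ℕ × ℕ × ℕ => φ (Function.update (Function.update (Function.update t α p.1) β p.2.1) γ p.2.2) := by
  funext p
  rw [Function.update_comm (Ne.symm hαγ) v p.1 t, Function.update_comm (Ne.symm hβγ) v p.2.1 (Function.update t α p.1),
    Function.update_idem]

/-- **Per-bond shell steps give S0's symmetric adjacency form**: bounds on the three forward shell steps of a cube datum `ψ` give `dist1 (ψ P·(ψ Q)⁻¹) ≤ η` for
every pair of shell points at `ℓ¹`-distance `1`. [folklore] -/
theorem shellAdj_of_steps {G : Type*} [GaugeGroup G] (n : ℕ) (ψ : ℕ × ℕ × ℕ → G) {η : ℝ}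
    (h1 : ∀ i k l, i + 1 ≤ n → k ≤ n → l ≤ n → (i = 0 ∨ i = n ∨ k = 0 ∨ k = n ∨ l = 0 ∨ l = n) →
      (i + 1 = n ∨ k = 0 ∨ k = n ∨ l = 0 ∨ l = n) → dist1 (ψ (i, k, l) * (ψ (i + 1, k, l))⁻¹) ≤ η)
    (h2 : ∀ i k l, i ≤ n → k + 1 ≤ n → l ≤ n → (i = 0 ∨ i = n ∨ k = 0 ∨ k = n ∨ l = 0 ∨ l = n) →
      (i = 0 ∨ i = n ∨ k + 1 = n ∨ l = 0 ∨ l = n) → dist1 (ψ (i, k, l) * (ψ (i, k + 1, l))⁻¹) ≤ η)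
    (h3 : ∀ i k l, i ≤ n → k ≤ n → l + 1 ≤ n → (i = 0 ∨ i = n ∨ k = 0 ∨ k = n ∨ l = 0 ∨ l = n) →
      (i = 0 ∨ i = n ∨ k = 0 ∨ k = n ∨ l + 1 = n) → dist1 (ψ (i, k, l) * (ψ (i, k, l + 1))⁻¹) ≤ η) :
    ∀ P Q : ℕ × ℕ × ℕ, P.1 ≤ n → P.2.1 ≤ n → P.2.2 ≤ n →
      (P.1 = 0 ∨ P.1 = n ∨ P.2.1 = 0 ∨ P.2.1 = n ∨ P.2.2 = 0 ∨ P.2.2 = n) →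
      Q.1 ≤ n → Q.2.1 ≤ n → Q.2.2 ≤ n →
      (Q.1 = 0 ∨ Q.1 = n ∨ Q.2.1 = 0 ∨ Q.2.1 = n ∨ Q.2.2 = 0 ∨ Q.2.2 = n) →
      Nat.dist P.1 Q.1 + Nat.dist P.2.1 Q.2.1 + Nat.dist P.2.2 Q.2.2 = 1 → dist1 (ψ P * (ψ Q)⁻¹) ≤ η := by
  rintro ⟨p1, p2, p3⟩ ⟨q1, q2, q3⟩ hp1 hp2 hp3 hpb hq1 hq2 hq3 hqb hd
  simp only at hp1 hp2 hp3 hpb hq1 hq2 hq3 hqb hd ⊢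
  unfold Nat.dist at hd
  by_cases c1 : q1 = p1 + 1
  · have e2 : q2 = p2 := by omega
    have e3 : q3 = p3 := by omega
    rw [c1, e2, e3]; exact h1 p1 p2 p3 (by omega) hp2 hp3 hpb (by omega)
  by_cases c2 : p1 = q1 + 1
  · have e2 : p2 = q2 := by omega
    have e3 : p3 = q3 := by omega
    rw [c2, e2, e3, ← GaugeGroup.dist1_inv, mul_inv_rev, inv_inv]; exact h1 q1 q2 q3 (by omega) hq2 hq3 hqb (by omega)
  by_cases c3 : q2 = p2 + 1
  · have e1 : q1 = p1 := by omega
    have e3 : q3 = p3 := by omega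
    rw [e1, c3, e3]; exact h2 p1 p2 p3 hp1 (by omega) hp3 hpb (by omega)
  by_cases c4 : p2 = q2 + 1
  · have e1 : p1 = q1 := by omega
    have e3 : p3 = q3 := by omega
    rw [e1, c4, e3, ← GaugeGroup.dist1_inv, mul_inv_rev, inv_inv]; exact h2 q1 q2 q3 hq1 (by omega) hq3 hqb (by omega)
  by_cases c5 : q3 = p3 + 1
  · have e1 : q1 = p1 := by omega
    have e2 : q2 = p2 := by omega
    rw [e1, e2, c5]; exact h3 p1 p2 p3 hp1 hp2 (by omega) hpb (by omega)
  · have c6 : p3 = q3 + 1 := by omega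
    have e1 : p1 = q1 := by omega
    have e2 : p2 = q2 := by omega
    rw [e1, e2, c6, ← GaugeGroup.dist1_inv, mul_inv_rev, inv_inv]; exact h3 q1 q2 q3 hq1 hq2 (by omega) hqb (by omega)

end Summit.QuantumFields.YangMills.Theorems.FluctuationComparisonRegPrIntLS2BetaCubeOffsetAlgebra
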